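import Summits.ValiantsHypothesis.ValiantsHypothesis.Theorems.GrenetZeonDualUnipotentThreeHalvesHeavyTopThmCnGradedCount

/-!
# `GrenetZeon.DualUnipotentThreeHalves` (stmt-ValiantsHypothesis-24318), R2 heavy-top instrument — UNIFORM THEOREM C, FILE 1:
# band calculus (products, traces and nilpotency of one-diagonal matrices)

Experiment cell «val-heavytop-census» (D-0160), engine seat val-htc-eng-1 g5.  Size-free matrix identities for the uniform (all `n`) kernel port
of THEOREM C («a nilpotent subspace of `M_n(ℂ)` of dimension `C(n,2) − 1` containing a regular nilpotent is reducible», val-idea-30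
MEMO codim-one rev 1.2; kernel so far only `n ≤ 7` by generated certificates).  Notation (no definitions — explicit `Matrix.of` terms):
the UPPER band of height `h` with row vector `x`, `U_h(x) = Σ_a x_a E_{a,a+h}` = `Matrix.of fun a b => if b = a + h then x a else 0`, and
the LOWER band `L_h(c) = Σ_b c_b E_{b+h,b}` = `Matrix.of fun a b => if a = b + h then c b else 0` (the conventions of ✓ `…ThmCnStructure`).

* `upperBand_mul_upperBand`, `lowerBand_mul_lowerBand`, `upperBand_mul_lowerBand` (a diagonal matrix), `trace_upperBand_mul_lowerBand`,
  `trace_lowerBand_mul_upperBand`, `shiftPow_eq_upperBand` (`J^h = U_h(𝟙)`);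
* `upper_mul`, `pow_apply_diag_of_upper`, `diag_eq_zero_of_isNilpotent_upper` — an upper triangular nilpotent matrix has zero diagonal;
* ★ `pair_eq_zero_of_isNilpotent_band` — the (P)-LEMMA of the memo in closed form: if `c_b c_{b+s} = 0` for all `b` and `U_s(x) + L_s(c)` is
  nilpotent then `x_a c_a = 0` for every `a` (the square is upper triangular with diagonal `x_a c_a + x_{a−s} c_{a−s}`);
* ★ `sum_sq_add_two_mul_sum_eq_zero` — for `U_s(x), L_s(y)` in a nilpotent space: `Σ_a (x_a y_a)² + 2 Σ_a (x_a y_a)(x_{a+s} y_{a+s}) = 0`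
  (the mixed second-order trace identity ✓ `trace_mixed_eq_zero_of_mem` with `m = 3`), and `sum_mul_eq_zero` (`Σ_a x_a y_a = 0`).

Honest framing: infrastructure; nothing here proves or refutes `HeavyTopLaw`/`HeavyTopSlowLaw`, 24318, S3 or 8062; `VP ≠ VNP` is NOT proved.
No definitions.  [val-idea-30 MEMO codim-one §1 (P)/(T3); this seat]
-/

noncomputable section

-- single-conjunct layout: Sub = Summit, duplicated namespace component intended
set_option linter.dupNamespace false

namespace Summit.ValiantsHypothesis.ValiantsHypothesis.Theorems.GrenetZeon.HeavyTopThmCBandCalculus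

open Matrix
open Summit.ValiantsHypothesis.ValiantsHypothesis.Theorems.GrenetZeon.HeavyTopThmCTraceKit
  (trace_mul_eq_zero_of_mem trace_mixed_eq_zero_of_mem)
open Summit.ValiantsHypothesis.ValiantsHypothesis.Theorems.GrenetZeon.HeavyTopThmCnGradedCount (shiftPow_apply)

variable {n : ℕ}

/-! ## Products of bands -/

/-- `U_h(x) · U_k(x') = U_{h+k}(a ↦ x_a x'_{a+h})`. -/
theorem upperBand_mul_upperBand (h k : ℕ) (x x' : Fin n → ℂ) :
    (Matrix.of fun a b : Fin n => if (b : ℕ) = (a : ℕ) + h then x a else 0) *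
      (Matrix.of fun a b : Fin n => if (b : ℕ) = (a : ℕ) + k then x' a else 0) =
      Matrix.of fun a b : Fin n => if (b : ℕ) = (a : ℕ) + (h + k) then
        (if ha : (a : ℕ) + h < n then x a * x' ⟨(a : ℕ) + h, ha⟩ else 0) else 0 := by
  ext a b
  rw [Matrix.mul_apply, Matrix.of_apply]
  by_cases ha : (a : ℕ) + h < n
  · rw [Finset.sum_eq_single ⟨(a : ℕ) + h, ha⟩]
    · simp only [Matrix.of_apply, if_true, dif_pos ha]
      by_cases hb : (b : ℕ) = (a : ℕ) + (h + k)
      · rw [if_pos (by simpa [add_assoc] using hb), if_pos hb]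
      · rw [if_neg (by simpa [add_assoc] using hb), if_neg hb, mul_zero]
    · intro j _ hj
      have : ¬ ((j : ℕ) = (a : ℕ) + h) := fun e => hj (Fin.ext e)
      simp only [Matrix.of_apply, if_neg this, zero_mul]
    · intro hh; exact absurd (Finset.mem_univ _) hh
  · rw [dif_neg ha]
    simp only [ite_self]
    refine Finset.sum_eq_zero fun j _ => ?_
    have : ¬ ((j : ℕ) = (a : ℕ) + h) := fun e => ha (by have := j.isLt; omega)
    simp only [Matrix.of_apply, if_neg this, zero_mul]

/-- `L_h(c) · L_k(c') = L_{h+k}(b ↦ c_{b+k} c'_b)`. -/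
theorem lowerBand_mul_lowerBand (h k : ℕ) (c c' : Fin n → ℂ) :
    (Matrix.of fun a b : Fin n => if (a : ℕ) = (b : ℕ) + h then c b else 0) *
      (Matrix.of fun a b : Fin n => if (a : ℕ) = (b : ℕ) + k then c' b else 0) =
      Matrix.of fun a b : Fin n => if (a : ℕ) = (b : ℕ) + (h + k) then
        (if hb : (b : ℕ) + k < n then c ⟨(b : ℕ) + k, hb⟩ * c' b else 0) else 0 := by
  ext a b
  rw [Matrix.mul_apply, Matrix.of_apply]
  by_cases hb : (b : ℕ) + k < n
  · rw [Finset.sum_eq_single ⟨(b : ℕ) + k, hb⟩]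
    · simp only [Matrix.of_apply, if_true, dif_pos hb]
      by_cases ha : (a : ℕ) = (b : ℕ) + (h + k)
      · rw [if_pos (show (a : ℕ) = ((⟨(b : ℕ) + k, hb⟩ : Fin n) : ℕ) + h from by dsimp only; omega), if_pos ha]
      · rw [if_neg (show ¬ ((a : ℕ) = ((⟨(b : ℕ) + k, hb⟩ : Fin n) : ℕ) + h) from by dsimp only; omega),
          if_neg ha, zero_mul]
    · intro j _ hj
      have : ¬ ((j : ℕ) = (b : ℕ) + k) := fun e => hj (Fin.ext e)
      simp only [Matrix.of_apply, if_neg this, mul_zero]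
    · intro hh; exact absurd (Finset.mem_univ _) hh
  · rw [dif_neg hb]
    simp only [ite_self]
    refine Finset.sum_eq_zero fun j _ => ?_
    have : ¬ ((j : ℕ) = (b : ℕ) + k) := fun e => hb (by have := j.isLt; omega)
    simp only [Matrix.of_apply, if_neg this, mul_zero]

/-- `U_h(x) · L_h(c) = diag(a ↦ x_a c_a [a + h < n])`. -/
theorem upperBand_mul_lowerBand (h : ℕ) (x c : Fin n → ℂ) :
    (Matrix.of fun a b : Fin n => if (b : ℕ) = (a : ℕ) + h then x a else 0) *
      (Matrix.of fun a b : Fin n => if (a : ℕ) = (b : ℕ) + h then c b else 0) =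
      Matrix.diagonal fun a : Fin n => if (a : ℕ) + h < n then x a * c a else 0 := by
  ext a b
  rw [Matrix.mul_apply, Matrix.diagonal_apply]
  by_cases ha : (a : ℕ) + h < n
  · rw [Finset.sum_eq_single ⟨(a : ℕ) + h, ha⟩]
    · simp only [Matrix.of_apply, if_true, if_pos ha]
      by_cases hab : a = b
      · subst hab; rw [if_pos rfl, if_pos rfl]
      · have : ¬ ((a : ℕ) + h = (b : ℕ) + h) := fun e => hab (Fin.ext (by omega))
        rw [if_neg this, if_neg hab, mul_zero]
    · intro j _ hj
      have : ¬ ((j : ℕ) = (a : ℕ) + h) := fun e => hj (Fin.ext e)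
      simp only [Matrix.of_apply, if_neg this, zero_mul]
    · intro hh; exact absurd (Finset.mem_univ _) hh
  · rw [if_neg ha]
    simp only [ite_self]
    refine Finset.sum_eq_zero fun j _ => ?_
    have : ¬ ((j : ℕ) = (a : ℕ) + h) := fun e => ha (by have := j.isLt; omega)
    simp only [Matrix.of_apply, if_neg this, zero_mul]

/-- `tr(U_h(x) · L_h(c)) = Σ_a x_a c_a [a + h < n]`. -/
theorem trace_upperBand_mul_lowerBand (h : ℕ) (x c : Fin n → ℂ) :
    Matrix.trace ((Matrix.of fun a b : Fin n => if (b : ℕ) = (a : ℕ) + h then x a else 0) *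
      (Matrix.of fun a b : Fin n => if (a : ℕ) = (b : ℕ) + h then c b else 0)) =
      ∑ a : Fin n, if (a : ℕ) + h < n then x a * c a else 0 := by
  rw [upperBand_mul_lowerBand, Matrix.trace_diagonal]

/-- `tr(L_h(c) · U_h(x)) = Σ_a x_a c_a [a + h < n]`. -/
theorem trace_lowerBand_mul_upperBand (h : ℕ) (x c : Fin n → ℂ) :
    Matrix.trace ((Matrix.of fun a b : Fin n => if (a : ℕ) = (b : ℕ) + h then c b else 0) *
      (Matrix.of fun a b : Fin n => if (b : ℕ) = (a : ℕ) + h then x a else 0)) =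
      ∑ a : Fin n, if (a : ℕ) + h < n then x a * c a else 0 := by
  rw [Matrix.trace_mul_comm, trace_upperBand_mul_lowerBand]

/-- The powers of the shift are the unit upper bands: `J^h = U_h(𝟙)`. -/
theorem shiftPow_eq_upperBand (h : ℕ) :
    (Matrix.of fun a b : Fin n => if (b : ℕ) = (a : ℕ) + 1 then (1 : ℂ) else 0) ^ h =
      Matrix.of fun a b : Fin n => if (b : ℕ) = (a : ℕ) + h then (fun _ : Fin n => (1 : ℂ)) a else 0 := by
  ext a b; rw [shiftPow_apply, Matrix.of_apply]

/-! ## Upper triangular nilpotent matrices have zero diagonal -/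

/-- Products of upper triangular matrices: upper triangular, with multiplicative diagonal. [folklore] -/
theorem upper_mul {A B : Matrix (Fin n) (Fin n) ℂ} (hA : ∀ a b : Fin n, (b : ℕ) < (a : ℕ) → A a b = 0)
    (hB : ∀ a b : Fin n, (b : ℕ) < (a : ℕ) → B a b = 0) :
    (∀ a b : Fin n, (b : ℕ) < (a : ℕ) → (A * B) a b = 0) ∧ ∀ a : Fin n, (A * B) a a = A a a * B a a := by
  constructor
  · intro a b hab
    rw [Matrix.mul_apply]
    refine Finset.sum_eq_zero fun j _ => ?_
    by_cases hj : (j : ℕ) < (a : ℕ)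
    · rw [hA a j hj, zero_mul]
    · rw [hB j b (by omega), mul_zero]
  · intro a
    rw [Matrix.mul_apply, Finset.sum_eq_single a]
    · intro j _ hj
      by_cases hj' : (j : ℕ) < (a : ℕ)
      · rw [hA a j hj', zero_mul]
      · have : (a : ℕ) < (j : ℕ) := lt_of_le_of_ne (by omega) (fun e => hj (Fin.ext e).symm)
        rw [hB j a this, mul_zero]
    · intro hh; exact absurd (Finset.mem_univ _) hh

/-- Powers of an upper triangular matrix: upper triangular with diagonal `(A_{aa})^k`. [folklore] -/
theorem pow_apply_diag_of_upper {A : Matrix (Fin n) (Fin n) ℂ} (hA : ∀ a b : Fin n, (b : ℕ) < (a : ℕ) → A a b = 0) (k : ℕ) :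
    (∀ a b : Fin n, (b : ℕ) < (a : ℕ) → (A ^ k) a b = 0) ∧ ∀ a : Fin n, (A ^ k) a a = A a a ^ k := by
  induction k with
  | zero =>
    refine ⟨fun a b hab => ?_, fun a => ?_⟩
    · rw [pow_zero, Matrix.one_apply, if_neg (fun e => by subst e; omega)]
    · rw [pow_zero, pow_zero, Matrix.one_apply, if_pos rfl]
  | succ k ih =>
    obtain ⟨h1, h2⟩ := upper_mul ih.1 hA
    refine ⟨fun a b hab => by rw [pow_succ]; exact h1 a b hab, fun a => ?_⟩
    rw [pow_succ, h2 a, ih.2 a, pow_succ]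

/-- ★ An upper triangular NILPOTENT matrix has zero diagonal. [folklore] -/
theorem diag_eq_zero_of_isNilpotent_upper {A : Matrix (Fin n) (Fin n) ℂ} (hA : ∀ a b : Fin n, (b : ℕ) < (a : ℕ) → A a b = 0)
    (hnil : IsNilpotent A) (a : Fin n) : A a a = 0 := by
  obtain ⟨k, hk⟩ := hnil
  have h := (pow_apply_diag_of_upper hA k).2 a
  rw [hk, Matrix.zero_apply] at h
  exact pow_eq_zero_iff'.1 h.symm |>.1

/-! ## The (P)-lemma: `U_s(x) + L_s(c)` nilpotent with `c_b c_{b+s} = 0` forces `x_a c_a = 0` -/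

/-- The square of `U_s(x) + L_s(c)` when `c_b c_{b+s} ≡ 0`: upper triangular, diagonal `x_a c_a [a+s<n] + c_{a−s} x_{a−s} [s ≤ a]`. -/
theorem band_sq_upper {s : ℕ} (hs : 1 ≤ s) (x c : Fin n → ℂ)
    (hq : ∀ b : Fin n, ∀ hb : (b : ℕ) + 2 * s < n, c ⟨(b : ℕ) + s, by omega⟩ * c b = 0) :
    let M := (Matrix.of fun a b : Fin n => if (b : ℕ) = (a : ℕ) + s then x a else 0) +
      (Matrix.of fun a b : Fin n => if (a : ℕ) = (b : ℕ) + s then c b else 0)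
    (∀ a b : Fin n, (b : ℕ) < (a : ℕ) → (M * M) a b = 0) ∧
      ∀ a : Fin n, (M * M) a a = (if (a : ℕ) + s < n then x a * c a else 0) +
        (if ha : s ≤ (a : ℕ) then c ⟨(a : ℕ) - s, by omega⟩ * x ⟨(a : ℕ) - s, by omega⟩ else 0) := by
  intro M
  have hMM : M * M =
      (Matrix.of fun a b : Fin n => if (b : ℕ) = (a : ℕ) + (s + s) then
        (if ha : (a : ℕ) + s < n then x a * x ⟨(a : ℕ) + s, ha⟩ else 0) else 0) +
      Matrix.diagonal (fun a : Fin n => if (a : ℕ) + s < n then x a * c a else 0) +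
      ((Matrix.of fun a b : Fin n => if (a : ℕ) = (b : ℕ) + s then c b else 0) *
        (Matrix.of fun a b : Fin n => if (b : ℕ) = (a : ℕ) + s then x a else 0)) +
      (Matrix.of fun a b : Fin n => if (a : ℕ) = (b : ℕ) + (s + s) then
        (if hb : (b : ℕ) + s < n then c ⟨(b : ℕ) + s, hb⟩ * c b else 0) else 0) := by
    simp only [M, Matrix.add_mul, Matrix.mul_add, upperBand_mul_upperBand, upperBand_mul_lowerBand, lowerBand_mul_lowerBand]
    abel
  -- entries of `L_s(c) U_s(x)`
  have hLU : ∀ a b : Fin n, ((Matrix.of fun a b : Fin n => if (a : ℕ) = (b : ℕ) + s then c b else 0) *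
      (Matrix.of fun a b : Fin n => if (b : ℕ) = (a : ℕ) + s then x a else 0)) a b =
      if a = b then (if ha : s ≤ (a : ℕ) then c ⟨(a : ℕ) - s, by omega⟩ * x ⟨(a : ℕ) - s, by omega⟩ else 0) else 0 := by
    intro a b
    rw [Matrix.mul_apply]
    by_cases ha : s ≤ (a : ℕ)
    · rw [Finset.sum_eq_single ⟨(a : ℕ) - s, by omega⟩]
      · simp only [Matrix.of_apply, dif_pos ha]
        rw [if_pos (show (a : ℕ) = ((⟨(a : ℕ) - s, by omega⟩ : Fin n) : ℕ) + s from by dsimp only; omega)]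
        by_cases hab : a = b
        · subst hab
          rw [if_pos (show (a : ℕ) = ((⟨(a : ℕ) - s, by omega⟩ : Fin n) : ℕ) + s from by dsimp only; omega), if_pos rfl]
        · rw [if_neg (show ¬ ((b : ℕ) = ((⟨(a : ℕ) - s, by omega⟩ : Fin n) : ℕ) + s) from fun e => hab (Fin.ext (by
            dsimp only at e; omega))), if_neg hab, mul_zero]
      · intro j _ hj
        have : ¬ ((a : ℕ) = (j : ℕ) + s) := fun e => hj (Fin.ext (by dsimp only; omega))
        simp only [Matrix.of_apply, if_neg this, zero_mul]
      · intro hh; exact absurd (Finset.mem_univ _) hh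
    · rw [dif_neg ha]
      simp only [ite_self]
      refine Finset.sum_eq_zero fun j _ => ?_
      have : ¬ ((a : ℕ) = (j : ℕ) + s) := fun e => ha (by omega)
      simp only [Matrix.of_apply, if_neg this, zero_mul]
  constructor
  · intro a b hab
    rw [hMM]
    have h1 : ¬ ((b : ℕ) = (a : ℕ) + (s + s)) := by omega
    have h2 : ¬ (a = b) := fun e => by subst e; omega
    simp only [Matrix.add_apply, Matrix.of_apply, Matrix.diagonal_apply, hLU, if_neg h1, if_neg h2, zero_add]
    by_cases h3 : (a : ℕ) = (b : ℕ) + (s + s)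
    · rw [if_pos h3, dif_pos (by omega)]
      exact hq b (by omega)
    · rw [if_neg h3]
  · intro a
    rw [hMM]
    have h1 : ¬ ((a : ℕ) = (a : ℕ) + (s + s)) := by omega
    simp only [Matrix.add_apply, Matrix.of_apply, Matrix.diagonal_apply, hLU, if_neg h1, if_true, zero_add, add_zero]

/-- ★ **The (P)-lemma.**  If `c_b c_{b+s} = 0` for every `b` (`b + 2s < n`) and `U_s(x) + L_s(c)` is nilpotent (`s ≥ 1`), then `x_a c_a = 0`
for every `a` with `a + s < n`.  [memo §1 (P), «supports without two consecutive edges»; this seat (closed form: the square is upper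
triangular with diagonal `x_a c_a + x_{a−s} c_{a−s}`, which must vanish)] -/
theorem pair_eq_zero_of_isNilpotent_band {s : ℕ} (hs : 1 ≤ s) (x c : Fin n → ℂ)
    (hq : ∀ b : Fin n, ∀ hb : (b : ℕ) + 2 * s < n, c ⟨(b : ℕ) + s, by omega⟩ * c b = 0)
    (hnil : IsNilpotent ((Matrix.of fun a b : Fin n => if (b : ℕ) = (a : ℕ) + s then x a else 0) +
      (Matrix.of fun a b : Fin n => if (a : ℕ) = (b : ℕ) + s then c b else 0))) :
    ∀ a : Fin n, (a : ℕ) + s < n → x a * c a = 0 := by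
  obtain ⟨hup, hdiag⟩ := band_sq_upper hs x c hq
  have hsq : IsNilpotent (((Matrix.of fun a b : Fin n => if (b : ℕ) = (a : ℕ) + s then x a else 0) +
      (Matrix.of fun a b : Fin n => if (a : ℕ) = (b : ℕ) + s then c b else 0)) *
      ((Matrix.of fun a b : Fin n => if (b : ℕ) = (a : ℕ) + s then x a else 0) +
      (Matrix.of fun a b : Fin n => if (a : ℕ) = (b : ℕ) + s then c b else 0))) := by
    rw [← pow_two]; exact hnil.pow_of_pos (by norm_num)
  have hd : ∀ a : Fin n, (if (a : ℕ) + s < n then x a * c a else 0) +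
      (if ha : s ≤ (a : ℕ) then c ⟨(a : ℕ) - s, by omega⟩ * x ⟨(a : ℕ) - s, by omega⟩ else 0) = 0 := by
    intro a
    rw [← hdiag a]
    exact diag_eq_zero_of_isNilpotent_upper hup hsq a
  -- induction on `a`
  suffices h : ∀ k : ℕ, ∀ a : Fin n, (a : ℕ) ≤ k → (a : ℕ) + s < n → x a * c a = 0 from fun a ha => h a a le_rfl ha
  intro k
  induction k with
  | zero =>
    intro a hak has
    have h0 := hd a
    rw [if_pos has, dif_neg (by omega), add_zero] at h0
    exact h0
  | succ k ih =>
    intro a hak has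
    have h0 := hd a
    rw [if_pos has] at h0
    by_cases hsa : s ≤ (a : ℕ)
    · have e := ih ⟨(a : ℕ) - s, by omega⟩ (by dsimp only; omega) (by dsimp only; omega)
      rw [dif_pos hsa, mul_comm (c _) (x _), e, add_zero] at h0
      exact h0
    · rw [dif_neg hsa, add_zero] at h0
      exact h0

/-! ## Second-order trace identities for a pair of opposite bands in a nilpotent space -/

/-- `Σ_a x_a y_a [a+s<n] = 0` for `U_s(x), L_s(y)` in a nilpotent space (`tr(XY) = 0`). -/
theorem sum_mul_eq_zero (W : Submodule ℂ (Matrix (Fin n) (Fin n) ℂ)) (hW : ∀ A ∈ W, IsNilpotent A) (s : ℕ) (x y : Fin n → ℂ)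
    (hX : (Matrix.of fun a b : Fin n => if (b : ℕ) = (a : ℕ) + s then x a else 0) ∈ W)
    (hY : (Matrix.of fun a b : Fin n => if (a : ℕ) = (b : ℕ) + s then y b else 0) ∈ W) :
    ∑ a : Fin n, (if (a : ℕ) + s < n then x a * y a else 0) = 0 := by
  rw [← trace_upperBand_mul_lowerBand]; exact trace_mul_eq_zero_of_mem W hW hX hY

/-- ★ **`Σ_a (x_a y_a)² + 2 Σ_a (x_a y_a)(x_{a+s} y_{a+s}) = 0`** for `U_s(x), L_s(y)` in a nilpotent space — the mixed second-order identity
`tr(Y·Y·X²) + tr(Y·X·Y·X) + tr(Y·X²·Y) = 0` (✓ `trace_mixed_eq_zero_of_mem`, `m = 3`) evaluated by the band calculus. [memo §1 (P) `j = 2`; this seat] -/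
theorem sum_sq_add_two_mul_sum_eq_zero (W : Submodule ℂ (Matrix (Fin n) (Fin n) ℂ)) (hW : ∀ A ∈ W, IsNilpotent A) (s : ℕ)
    (x y : Fin n → ℂ)
    (hX : (Matrix.of fun a b : Fin n => if (b : ℕ) = (a : ℕ) + s then x a else 0) ∈ W)
    (hY : (Matrix.of fun a b : Fin n => if (a : ℕ) = (b : ℕ) + s then y b else 0) ∈ W) :
    (∑ a : Fin n, (if (a : ℕ) + s < n then x a * y a else 0) ^ 2) +
      2 * ∑ a : Fin n, (if ha : (a : ℕ) + 2 * s < n then x a * y a * (x ⟨(a : ℕ) + s, by omega⟩ * y ⟨(a : ℕ) + s, by omega⟩) else 0) = 0 := by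
  set X : Matrix (Fin n) (Fin n) ℂ := Matrix.of fun a b : Fin n => if (b : ℕ) = (a : ℕ) + s then x a else 0 with hXdef
  set Y : Matrix (Fin n) (Fin n) ℂ := Matrix.of fun a b : Fin n => if (a : ℕ) = (b : ℕ) + s then y b else 0 with hYdef
  have hmix := trace_mixed_eq_zero_of_mem W hW (A := X) (E := Y) (X := Y) hX hY hY 3
  simp only [Finset.sum_range_succ, Finset.sum_range_zero, zero_add, show 3 - 1 - 0 = 2 from rfl, show 3 - 1 - 1 = 1 from rfl,
    show 3 - 1 - 2 = 0 from rfl, pow_zero, pow_one, Matrix.one_mul, Matrix.mul_one] at hmix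
  -- the three traces
  have hXX : X ^ 2 = Matrix.of fun a b : Fin n => if (b : ℕ) = (a : ℕ) + (s + s) then
      (if ha : (a : ℕ) + s < n then x a * x ⟨(a : ℕ) + s, ha⟩ else 0) else 0 := by
    rw [pow_two, hXdef, upperBand_mul_upperBand]
  have hYY : Y * Y = Matrix.of fun a b : Fin n => if (a : ℕ) = (b : ℕ) + (s + s) then
      (if hb : (b : ℕ) + s < n then y ⟨(b : ℕ) + s, hb⟩ * y b else 0) else 0 := by
    rw [hYdef, lowerBand_mul_lowerBand]
  have cross : Matrix.trace ((Matrix.of fun a b : Fin n => if (b : ℕ) = (a : ℕ) + (s + s) then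
      (if ha : (a : ℕ) + s < n then x a * x ⟨(a : ℕ) + s, ha⟩ else 0) else 0) *
      (Matrix.of fun a b : Fin n => if (a : ℕ) = (b : ℕ) + (s + s) then
      (if hb : (b : ℕ) + s < n then y ⟨(b : ℕ) + s, hb⟩ * y b else 0) else 0)) =
      ∑ a : Fin n, (if ha : (a : ℕ) + 2 * s < n then x a * y a * (x ⟨(a : ℕ) + s, by omega⟩ * y ⟨(a : ℕ) + s, by omega⟩) else 0) := by
    rw [trace_upperBand_mul_lowerBand]
    refine Finset.sum_congr rfl fun a _ => ?_
    by_cases ha : (a : ℕ) + 2 * s < n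
    · rw [if_pos (by omega), dif_pos ha, dif_pos (by omega), dif_pos (by omega)]; ring
    · rw [if_neg (by omega), dif_neg ha]
  have t1 : Matrix.trace (Y * (Y * X ^ 2)) =
      ∑ a : Fin n, (if ha : (a : ℕ) + 2 * s < n then x a * y a * (x ⟨(a : ℕ) + s, by omega⟩ * y ⟨(a : ℕ) + s, by omega⟩) else 0) := by
    rw [← Matrix.mul_assoc, hYY, hXX, Matrix.trace_mul_comm, cross]
  have t3 : Matrix.trace (Y * (X ^ 2 * Y)) =
      ∑ a : Fin n, (if ha : (a : ℕ) + 2 * s < n then x a * y a * (x ⟨(a : ℕ) + s, by omega⟩ * y ⟨(a : ℕ) + s, by omega⟩) else 0) := by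
    rw [Matrix.trace_mul_comm, Matrix.mul_assoc, hYY, hXX, cross]
  have t2 : Matrix.trace (Y * (X * Y * X)) = ∑ a : Fin n, (if (a : ℕ) + s < n then x a * y a else 0) ^ 2 := by
    rw [Matrix.trace_mul_comm, Matrix.mul_assoc, hXdef, hYdef, upperBand_mul_lowerBand, Matrix.diagonal_mul_diagonal,
      Matrix.trace_diagonal]
    refine Finset.sum_congr rfl fun a _ => ?_
    split_ifs <;> ring
  rw [t1, t2, t3] at hmix
  linear_combination hmix

end Summit.ValiantsHypothesis.ValiantsHypothesis.Theorems.GrenetZeon.HeavyTopThmCBandCalculus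

end
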